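import Mathlib
import HarnessLib
import Literature.Computability.AlgebraicComplexity.PatternExpressions
import Summits.ValiantsHypothesis.ValiantsHypothesis.Theorems.MonotoneRestorationOrbitCompressionQPNarrowClosureSums
import Summits.ValiantsHypothesis.ValiantsHypothesis.Theorems.MonotoneRestorationOrbitCompressionQPNarrowMatrixProduct

/-!
# Route MonotoneRestoration — aside `OrbitCompressionQP` (stmt-ValiantsHypothesis-18332), line
# `expression_compression`: the elementary symmetric polynomials of the ROW SUMS — in particular the row
# product `∏_i Σ_j x_ij` — are narrow of quasi-polynomial length

The first landed members of «NQP» (the conclusion of `stub_narrowExpressionCompression`) that are beyond the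
reach of the homomorphism-polynomial span machine: `e_d(r_1, …, r_n)` with `r_i = Σ_j x_ij`, for any
quasi-polynomially bounded `d = d(n)`; at `d = n` this is the ROW PRODUCT `∏_i Σ_j x_ij`, a matrix-symmetric
`VP` family (formula size `n²`) whose expansion in homomorphism polynomials of bipartite patterns has `p(n)`
(partition number, `e^{Θ(√n)}`) terms, so that no quasi-polynomial presentation can be read off a span.  The
presentation here is Newton's recurrence `t e_t = Σ_{j<t} (-1)^{t-j+1} e_j p_{t-j}` (Mathlib's
`MvPolynomial.mul_esymm_eq_sum`, evaluated at the row sums), run as an iterated product of `d` matrices of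
dimension `d + 1` whose entries are constants and scaled power sums `p_b = Σ_i r_i^b` (closed `(1,1)`-label
expressions of length `3b + 2`), balanced by `NarrowClosure.exists_matrixProd` into expressions of length
`(2d+4)^{log₂ d + 1} (4d + 6) + 2 = 2^{O(log² d)}`:

* `newton_esymm_rowSums` — the solved Newton identity for the row sums over `ℂ`;
* `prod_newtonMatrices_col_zero` — column `0` of `M_t ⋯ M_1` is `(e_0, …, e_t, 0, …, 0)`;
* `narrowQP_esymmRowSums` — **`n ↦ e_{d n}(r_1, …, r_n)` is narrow of quasi-polynomial length** (one row and
  one column label) for every quasi-polynomially bounded `d`; `narrowQP_rowProduct` — the row product.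

Helper file (`--supports stmt-ValiantsHypothesis-18332`); def-free; nothing here is a named fact; VP ≠ VNP is
not moved.
-/

noncomputable section

open MvPolynomial

-- `Summit.ValiantsHypothesis.ValiantsHypothesis.…` is the tree's single-conjunct layout (Sub = Summit).
set_option linter.dupNamespace false

namespace Summit.ValiantsHypothesis.ValiantsHypothesis.Theorems

namespace NarrowClosure

open Literature.Computability.AlgebraicComplexity

variable {n : ℕ}

/-! ### Newton's identity for the row sums, solved for `e_m` -/

/-- **Newton's identity at the row sums, solved form** (`m ≥ 1`, over `ℂ`):
`e_m(r) = m⁻¹ (-1)^{m+1} Σ_{j < m} (-1)^j e_j(r) p_{m-j}(r)` with `r_i = Σ_j x_ij`, `p_b(r) = Σ_i r_i^b`.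
[folklore] -/
theorem newton_esymm_rowSums (m : ℕ) (hm : 0 < m) :
    aeval (fun i : Fin n => ∑ j : Fin n, (X (i, j) : MvPolynomial (Fin n × Fin n) ℂ)) (esymm (Fin n) ℂ m) =
      ((m : ℂ)⁻¹ * (-1) ^ (m + 1)) • ∑ a ∈ Finset.range m,
        (-1) ^ a * aeval (fun i : Fin n => ∑ j : Fin n, (X (i, j) : MvPolynomial (Fin n × Fin n) ℂ))
          (esymm (Fin n) ℂ a) *
        ∑ i : Fin n, (∑ j : Fin n, (X (i, j) : MvPolynomial (Fin n × Fin n) ℂ)) ^ (m - a) := by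
  set R : Fin n → MvPolynomial (Fin n × Fin n) ℂ := fun i => ∑ j : Fin n, X (i, j) with hR
  have key := congrArg (aeval R) (MvPolynomial.mul_esymm_eq_sum (Fin n) ℂ m)
  rw [map_mul, map_natCast, map_mul, map_pow, map_neg, map_one, map_sum] at key
  have hpsum : ∀ b : ℕ, aeval R (psum (Fin n) ℂ b) = ∑ i : Fin n, R i ^ b := by
    intro b; simp [psum, map_sum, map_pow]
  have hsum : ∑ a ∈ Finset.HasAntidiagonal.antidiagonal m with a.1 < m,
      aeval R ((-1) ^ a.1 * esymm (Fin n) ℂ a.1 * psum (Fin n) ℂ a.2) =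
      ∑ a ∈ Finset.range m, (-1) ^ a * aeval R (esymm (Fin n) ℂ a) * ∑ i : Fin n, R i ^ (m - a) := by
    rw [Finset.sum_filter, Finset.Nat.sum_antidiagonal_eq_sum_range_succ_mk, Finset.sum_range_succ]
    simp only [lt_irrefl, if_false, add_zero]
    refine Finset.sum_congr rfl fun a ha => ?_
    rw [if_pos (Finset.mem_range.1 ha), map_mul, map_mul, map_pow, map_neg, map_one, hpsum]
  rw [hsum] at key
  have hm0 : (m : ℂ) ≠ 0 := Nat.cast_ne_zero.2 hm.ne'
  calc aeval R (esymm (Fin n) ℂ m)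
      = ((m : ℂ)⁻¹ * (m : ℂ)) • aeval R (esymm (Fin n) ℂ m) := by rw [inv_mul_cancel₀ hm0, one_smul]
    _ = (m : ℂ)⁻¹ • ((m : MvPolynomial (Fin n × Fin n) ℂ) * aeval R (esymm (Fin n) ℂ m)) := by
        rw [← smul_smul, smul_eq_C_mul (aeval R _) (m : ℂ), map_natCast]
    _ = _ := by rw [key, ← smul_smul, smul_eq_C_mul _ ((-1 : ℂ) ^ (m + 1)), map_pow, map_neg, map_one]

/-! ### Newton's recurrence as an iterated matrix product: column `0` -/

/-- **Column `0` of the Newton matrix product.**  With `V u` the matrix of dimension `D + 1` that is the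
identity except in row `u + 1`, where it carries the Newton coefficients
`C((u+1)⁻¹ (-1)^{u+2} (-1)^j) · Ps_{u+1-j}` in the columns `j < u + 1`: if `E 0 = 1` and `E` satisfies
Newton's recurrence against `Ps` up to `D`, then column `0` of `V_{t-1} ⋯ V_0` is `(E 0, …, E t, 0, …, 0)`
(`t ≤ D`). [folklore] -/
theorem prod_newton_col_zero {S : Type} [CommRing S] [Algebra ℂ S] (D : ℕ) (E Ps : ℕ → S) (hE0 : E 0 = 1)
    (hNewton : ∀ m : ℕ, 0 < m → m ≤ D →
      E m = algebraMap ℂ S ((m : ℂ)⁻¹ * (-1) ^ (m + 1)) *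
        ∑ a ∈ Finset.range m, (-1) ^ a * E a * Ps (m - a)) :
    ∀ t : ℕ, t ≤ D → ∀ i : Fin (D + 1),
      (((List.range t).reverse.map fun u : ℕ => Matrix.of fun i j : Fin (D + 1) =>
          if (i : ℕ) = u + 1 then
            (if (j : ℕ) < u + 1 then
              algebraMap ℂ S ((((u + 1 : ℕ) : ℂ))⁻¹ * (-1) ^ (u + 2) * (-1) ^ (j : ℕ)) * Ps (u + 1 - j)
             else 0)
          else (if i = j then 1 else 0)).prod) i 0 =
        if (i : ℕ) ≤ t then E i else 0 := by
  intro t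
  induction t with
  | zero =>
    intro _ i
    simp only [List.range_zero, List.reverse_nil, List.map_nil, List.prod_nil, Matrix.one_apply,
      Nat.le_zero, Fin.ext_iff, Fin.val_zero]
    split_ifs with h
    · rw [show (i : ℕ) = 0 from h, hE0]
    · rfl
  | succ t ih =>
    intro ht i
    rw [List.range_succ, List.reverse_append, List.reverse_singleton, List.singleton_append, List.map_cons,
      List.prod_cons, Matrix.mul_apply]
    simp only [Matrix.of_apply]
    simp_rw [ih (by omega)]
    by_cases hi : (i : ℕ) = t + 1
    · -- the Newton row
      simp only [hi, if_true, le_refl]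
      rw [hNewton (t + 1) (by omega) ht, Finset.mul_sum,
        Fin.sum_univ_eq_sum_range (fun j : ℕ =>
          (if j < t + 1 then algebraMap ℂ S ((((t + 1 : ℕ) : ℂ))⁻¹ * (-1) ^ (t + 2) * (-1) ^ j) *
            Ps (t + 1 - j) else 0) * (if j ≤ t then E j else 0)) (D + 1)]
      have key : ∑ a ∈ Finset.range (t + 1),
          (if a < t + 1 then algebraMap ℂ S ((((t + 1 : ℕ) : ℂ))⁻¹ * (-1) ^ (t + 2) * (-1) ^ a) *
            Ps (t + 1 - a) else 0) * (if a ≤ t then E a else 0) =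
          ∑ a ∈ Finset.range (D + 1),
          (if a < t + 1 then algebraMap ℂ S ((((t + 1 : ℕ) : ℂ))⁻¹ * (-1) ^ (t + 2) * (-1) ^ a) *
            Ps (t + 1 - a) else 0) * (if a ≤ t then E a else 0) :=
        Finset.sum_subset (fun x hx => Finset.mem_range.2
          (lt_of_lt_of_le (Finset.mem_range.1 hx) (Nat.le_succ_of_le ht))) (by
          intro a _ ha
          have : ¬ a < t + 1 := fun h => ha (Finset.mem_range.2 h)
          rw [if_neg this, zero_mul])
      rw [← key]
      refine Finset.sum_congr rfl fun a ha => ?_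
      have h1 : a < t + 1 := Finset.mem_range.1 ha
      rw [if_pos h1, if_pos (by omega)]
      simp only [map_mul, map_pow, map_neg, map_one]
      ring
    · -- an identity row
      simp only [hi, if_false]
      rw [Finset.sum_eq_single i (fun j _ hj => by rw [if_neg (Ne.symm hj), zero_mul])
        (fun h => absurd (Finset.mem_univ i) h), if_pos rfl, one_mul]
      by_cases h1 : (i : ℕ) ≤ t
      · rw [if_pos h1, if_pos (by omega)]
      · rw [if_neg h1, if_neg (by omega)]

/-! ### Power sums of the row sums as closed-value expressions -/

/-- The power sum `Σ_i (Σ_j x_ij)^b` is the value — at every label assignment — of a `(1,1)`-label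
expression of length `3b + 2`. [folklore] -/
theorem exists_powerSumExpr (n b : ℕ) : ∃ q : PatternExpr ℂ 1 1, q.length = 3 * b + 2 ∧
    ∀ (ρ γ : Fin 1 → Fin n), q.value n ρ γ =
      ∑ i : Fin n, (∑ j : Fin n, (X (i, j) : MvPolynomial (Fin n × Fin n) ℂ)) ^ b := by
  obtain ⟨pw, hlen, hval⟩ := exists_value_eq_pow
    (PatternExpr.sumCol 0 (PatternExpr.edge 0 0) : PatternExpr ℂ 1 1) b
  refine ⟨PatternExpr.sumRow 0 pw, by simp [PatternExpr.length, hlen]; ring, fun ρ γ => ?_⟩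
  simp [PatternExpr.value_sumRow, hval, Function.update_self]

/-! ### Arithmetic -/

/-- Length bookkeeping: `(2D+4)^{log₂ D + 1} (4D+6) + 2 ≤ 2^{(log₂ n + c')^{c'}}` when `D ≤ 2^{(log₂ n + a)^a}`.
[folklore] -/
theorem esymm_length_qp (a : ℕ) : ∃ c' : ℕ, ∀ L D : ℕ, D ≤ 2 ^ ((L + a) ^ a) →
    (2 * D + 4) ^ (Nat.log 2 D + 1) * (4 * D + 6) + 2 ≤ 2 ^ ((L + c') ^ c') := by
  obtain ⟨c', hc'⟩ := CompressionFloors.polylog_master a 3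
  refine ⟨c', fun L D hD => ?_⟩
  set M := (L + a) ^ a with hM
  set β := (L + a) ^ a + L + 2 with hβ
  have hM1 : 1 ≤ M := by
    rcases Nat.eq_zero_or_pos a with h0 | h0
    · simp [hM, h0]
    · exact Nat.one_le_pow _ _ (by omega)
  have hlog : Nat.log 2 D ≤ M :=
    (Nat.log_mono_right hD).trans (by rw [Nat.log_pow (by norm_num)])
  have h2M : 1 ≤ 2 ^ M := Nat.one_le_two_pow
  have h24 : 2 * D + 4 ≤ 2 ^ (M + 3) := by
    have : 2 ^ (M + 3) = 2 ^ M * 8 := by rw [pow_add]; norm_num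
    omega
  have h46 : 4 * D + 6 ≤ 2 ^ (M + 4) := by
    have : 2 ^ (M + 4) = 2 ^ M * 16 := by rw [pow_add]; norm_num
    omega
  have hA : (2 * D + 4) ^ (Nat.log 2 D + 1) ≤ 2 ^ ((M + 3) * (M + 1)) := by
    calc (2 * D + 4) ^ (Nat.log 2 D + 1) ≤ (2 ^ (M + 3)) ^ (Nat.log 2 D + 1) := Nat.pow_le_pow_left h24 _
      _ ≤ (2 ^ (M + 3)) ^ (M + 1) := Nat.pow_le_pow_right (by positivity) (by omega)
      _ = 2 ^ ((M + 3) * (M + 1)) := by rw [← pow_mul]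
  have hexp : (M + 3) * (M + 1) + (M + 4) + 1 ≤ β ^ 3 := by
    have hb : M + 2 ≤ β := by omega
    have hβ3 : 3 ≤ β := by omega
    have e1 : (M + 3) * (M + 1) ≤ (β + 1) * β := Nat.mul_le_mul (by omega) (by omega)
    have e2 : β * β + β * β ≤ β ^ 3 := by
      calc β * β + β * β = 2 * (β * β) := by ring
        _ ≤ β * (β * β) := Nat.mul_le_mul_right _ (by omega)
        _ = β ^ 3 := by ring
    have e3 : (β + 1) * β + (M + 4) + 1 ≤ β * β + β * β := by nlinarith
    calc (M + 3) * (M + 1) + (M + 4) + 1 ≤ (β + 1) * β + (M + 4) + 1 :=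
        Nat.add_le_add_right (Nat.add_le_add_right e1 _) _
      _ ≤ β * β + β * β := e3
      _ ≤ β ^ 3 := e2
  have h1 : 2 ≤ 2 ^ ((M + 3) * (M + 1) + (M + 4)) :=
    le_trans (by norm_num) (Nat.pow_le_pow_right (by norm_num) (le_add_left (by omega) :
      1 ≤ (M + 3) * (M + 1) + (M + 4)))
  calc (2 * D + 4) ^ (Nat.log 2 D + 1) * (4 * D + 6) + 2
      ≤ 2 ^ ((M + 3) * (M + 1)) * 2 ^ (M + 4) + 2 := Nat.add_le_add_right (Nat.mul_le_mul hA h46) 2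
    _ = 2 ^ ((M + 3) * (M + 1) + (M + 4)) + 2 := by rw [← pow_add]
    _ ≤ 2 ^ ((M + 3) * (M + 1) + (M + 4) + 1) := by
        rw [pow_succ]
        have := h1
        generalize 2 ^ ((M + 3) * (M + 1) + (M + 4)) = Y at this ⊢
        omega
    _ ≤ 2 ^ (β ^ 3) := Nat.pow_le_pow_right (by norm_num) hexp
    _ ≤ 2 ^ ((L + c') ^ c') := Nat.pow_le_pow_right (by norm_num) (hc' L _ le_rfl)

/-! ### The theorem -/

/-- **The elementary symmetric polynomials of the row sums are narrow of quasi-polynomial length.**  For every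
quasi-polynomially bounded `d`, the family `n ↦ e_{d n}(r_1, …, r_n)`, `r_i = Σ_j x_ij`, satisfies the
conclusion of `stub_narrowExpressionCompression` with one row and one column label. [folklore] -/
theorem narrowQP_esymmRowSums (d : ℕ → ℕ) (hd : ∃ c : ℕ, ∀ n : ℕ, d n ≤ 2 ^ ((Nat.log 2 n + c) ^ c)) :
    ∃ c : ℕ, ∀ n : ℕ, 1 ≤ n → ∃ (k l : ℕ) (e : PatternExpr ℂ k l),
      n ^ (k + l) ≤ 2 ^ ((Nat.log 2 n + c) ^ c) ∧ e.length ≤ 2 ^ ((Nat.log 2 n + c) ^ c) ∧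
      e.close n = aeval (fun i : Fin n => ∑ j : Fin n, (X (i, j) : MvPolynomial (Fin n × Fin n) ℂ))
        (esymm (Fin n) ℂ (d n)) := by
  classical
  obtain ⟨a, ha⟩ := hd
  obtain ⟨c₁, hc₁⟩ := CompressionFloors.labels_qp 1
  obtain ⟨c₂, hc₂⟩ := esymm_length_qp a
  refine ⟨max c₁ c₂, fun n hn => ?_⟩
  set D := d n with hD
  set R : Fin n → MvPolynomial (Fin n × Fin n) ℂ := fun i => ∑ j : Fin n, X (i, j) with hR
  set E : ℕ → MvPolynomial (Fin n × Fin n) ℂ := fun m => aeval R (esymm (Fin n) ℂ m) with hE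
  set Ps : ℕ → MvPolynomial (Fin n × Fin n) ℂ := fun b => ∑ i : Fin n, R i ^ b with hPs
  have hE0 : E 0 = 1 := by simp [hE, esymm_zero]
  have hNewton : ∀ m : ℕ, 0 < m → m ≤ D →
      E m = algebraMap ℂ _ ((m : ℂ)⁻¹ * (-1) ^ (m + 1)) * ∑ b ∈ Finset.range m, (-1) ^ b * E b * Ps (m - b) := by
    intro m hm _
    rw [hE]
    simp only
    rw [newton_esymm_rowSums m hm, Algebra.smul_def]
  -- the power-sum expressions and the Newton matrices of expressions
  choose pw hpw_len hpw_val using exists_powerSumExpr n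
  set Mx : ℕ → Matrix (Fin (D + 1)) (Fin (D + 1)) (PatternExpr ℂ 1 1) := fun u => Matrix.of fun i j =>
    if (i : ℕ) = u + 1 then
      (if (j : ℕ) < u + 1 then
        PatternExpr.mul (PatternExpr.const ((((u + 1 : ℕ) : ℂ))⁻¹ * (-1) ^ (u + 2) * (-1) ^ (j : ℕ)))
          (pw (u + 1 - j))
       else PatternExpr.const 0)
    else (if i = j then PatternExpr.const 1 else PatternExpr.const 0) with hMx
  have hMx_len : ∀ u, u < D → ∀ i j, (Mx u i j).length ≤ 3 * D + 4 := by
    intro u hu i j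
    simp only [hMx, Matrix.of_apply]
    split_ifs with h1 h2
    · simp only [PatternExpr.length, hpw_len]
      have : u + 1 - (j : ℕ) ≤ D := by omega
      omega
    all_goals simp [PatternExpr.length]
  have hMx_val : ∀ u (ρ γ : Fin 1 → Fin n), ((Mx u).map fun e => e.value n ρ γ) =
      Matrix.of fun i j : Fin (D + 1) =>
        if (i : ℕ) = u + 1 then
          (if (j : ℕ) < u + 1 then
            algebraMap ℂ _ ((((u + 1 : ℕ) : ℂ))⁻¹ * (-1) ^ (u + 2) * (-1) ^ (j : ℕ)) * Ps (u + 1 - j)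
           else 0)
        else (if i = j then 1 else 0) := by
    intro u ρ γ
    ext i j
    simp only [hMx, Matrix.map_apply, Matrix.of_apply]
    split_ifs <;> simp [hpw_val, hPs, hR, MvPolynomial.algebraMap_eq]
  -- balance the product of the `D` Newton matrices
  set Lm := (List.range D).reverse.map Mx with hLm
  have hLlen : Lm.length ≤ 2 ^ (Nat.log 2 D + 1) := by
    rw [hLm, List.length_map, List.length_reverse, List.length_range]
    exact (Nat.lt_pow_succ_log_self Nat.one_lt_two D).le
  obtain ⟨P, hPlen, hPval⟩ := exists_matrixProd (3 * D + 4) (Nat.log 2 D + 1) Lm hLlen (by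
    intro M hM i j
    rw [hLm, List.mem_map] at hM
    obtain ⟨u, hu, rfl⟩ := hM
    exact hMx_len u (by simpa using hu) i j)
  -- the value of the `(D, 0)` entry is `e_D`
  have hval : ∀ (ρ γ : Fin 1 → Fin n), (P ⟨D, Nat.lt_succ_self D⟩ 0).value n ρ γ = E D := by
    intro ρ γ
    have h := congrFun (congrFun (hPval n ρ γ) ⟨D, Nat.lt_succ_self D⟩) 0
    rw [Matrix.map_apply] at h
    rw [h, hLm, List.map_map]
    simp only [Function.comp_def]
    rw [List.map_congr_left (fun u _ => hMx_val u ρ γ)]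
    have hcol := prod_newton_col_zero D E Ps hE0 hNewton D le_rfl ⟨D, Nat.lt_succ_self D⟩
    rw [if_pos le_rfl] at hcol
    exact hcol
  have hn0 : ((n * n : ℕ) : ℂ) ≠ 0 := by
    have : 0 < n := hn
    exact Nat.cast_ne_zero.2 (by positivity)
  refine ⟨1, 1, PatternExpr.mul (PatternExpr.const (((n * n : ℕ) : ℂ))⁻¹) (P ⟨D, Nat.lt_succ_self D⟩ 0),
    ?_, ?_, ?_⟩
  · exact (hc₁ n 1 (by rw [pow_one]; exact Nat.le_add_left 1 _)).trans
      (Nat.pow_le_pow_right (by norm_num) (CompressionFloors.polylog_mono (le_max_left _ _)))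
  · have hl : (PatternExpr.mul (PatternExpr.const (((n * n : ℕ) : ℂ))⁻¹)
        (P ⟨D, Nat.lt_succ_self D⟩ 0)).length = (P ⟨D, Nat.lt_succ_self D⟩ 0).length + 2 := by
      simp [PatternExpr.length]; ring
    rw [hl]
    calc (P ⟨D, Nat.lt_succ_self D⟩ 0).length + 2
        ≤ (2 * (D + 1) + 2) ^ (Nat.log 2 D + 1) * (3 * D + 4 + (D + 1) + 1) + 2 :=
          Nat.add_le_add_right (hPlen _ _) 2
      _ = (2 * D + 4) ^ (Nat.log 2 D + 1) * (4 * D + 6) + 2 := by ring_nf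
      _ ≤ 2 ^ ((Nat.log 2 n + c₂) ^ c₂) := hc₂ _ _ (ha n)
      _ ≤ _ := Nat.pow_le_pow_right (by norm_num) (CompressionFloors.polylog_mono (le_max_right _ _))
  · rw [ShortClose.close_const_mul, close_eq_of_value_const _ _ hval, smul_smul, inv_mul_cancel₀ hn0,
      one_smul]

/-- **The row product `∏_i Σ_j x_ij` is narrow of quasi-polynomial length** (`e_n` of the `n` row sums).
[folklore] -/
theorem narrowQP_rowProduct :
    ∃ c : ℕ, ∀ n : ℕ, 1 ≤ n → ∃ (k l : ℕ) (e : PatternExpr ℂ k l),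
      n ^ (k + l) ≤ 2 ^ ((Nat.log 2 n + c) ^ c) ∧ e.length ≤ 2 ^ ((Nat.log 2 n + c) ^ c) ∧
      e.close n = ∏ i : Fin n, ∑ j : Fin n, (X (i, j) : MvPolynomial (Fin n × Fin n) ℂ) := by
  obtain ⟨c, hc⟩ := narrowQP_esymmRowSums (fun n => n) ⟨1, fun n =>
    (Nat.lt_pow_succ_log_self Nat.one_lt_two n).le.trans (by rw [pow_one])⟩
  refine ⟨c, fun n hn => ?_⟩
  obtain ⟨k, l, e, hkl, hlen, hclose⟩ := hc n hn
  refine ⟨k, l, e, hkl, hlen, ?_⟩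
  rw [hclose]
  have h2 : Finset.powersetCard n (Finset.univ : Finset (Fin n)) = {Finset.univ} := by
    have h := Finset.powersetCard_self (Finset.univ : Finset (Fin n))
    rwa [Finset.card_univ, Fintype.card_fin] at h
  have : esymm (Fin n) ℂ n = ∏ i : Fin n, X i := by
    rw [MvPolynomial.esymm, h2, Finset.sum_singleton]
  rw [this, map_prod]
  simp

end NarrowClosure

end Summit.ValiantsHypothesis.ValiantsHypothesis.Theorems

end
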